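import Summits.CriticalPhenomena.PercolationContinuityZ3.Theorems.PercNearOneGluingNoHeavyQuantCrossingWindowOneArm
import Summits.CriticalPhenomena.PercolationContinuityZ3.Theorems.PercNearOneGluingNoHeavyQuantSixDisplays
import HarnessLib

/-!
# The one-arm window on `ℤ³` with every constant a kernel numeral (the lane's display of record `2⁻²⁴⁴⁶`)

builds on p205010 (kernel theorem, internal audit signed; external expert review pending) — only through the lane's effective
re-proof (`Quant.EpsSharp.oneArm_rate_Z3_six_sharp`: additive gluing + BGN + DKT Prop. 1 at the Peierls constant `2⁻⁶`).

QUANT lane (`prim-quant`), seat p4 (METHOD: differential inequalities for `θ` near `p_c`), gen 14; helper file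
`--supports stmt-CriticalPhenomena-4575`; pure proofs, no definitions, no sorries.  The one-arm window of
`…QuantCrossingWindowOneArm.lean` (`(p_c − p)²·16d(8L+1)^d·θ_L(p_c) ≤ 85^{−d}p(1−p_c) ⟹ u_p(L,4L) ≥ 85^{−d}/4`) with `θ_L(p_c(ℤ³))`
replaced by the display of record `π_{p_c(ℤ³)}(L) ≤ (1 − 2⁻²⁴⁴⁶)^⌊(log*₂ L − 6)/2⌋` (V180, p250116):

* `le_real_boxCrossing_of_window_Z3_numeral` — for `0 < p ≤ p_c(ℤ³)`, `L ≥ 1`: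
  **`(p_c − p)²·48(8L+1)³·(1 − 2⁻²⁴⁴⁶)^⌊(log*₂ L − 6)/2⌋ ≤ 85⁻³·p·(1 − p_c) ⟹ P_p(Λ(L) ↔ ∂ⁱⁿΛ(4L) in Λ(4L)) ≥ 85⁻³/4`**.

HONEST SIZE: the numeral factor `8(1 − 2⁻²⁴⁴⁶)^⌊(log*₂ L − 6)/2⌋` in front of lane 3's edge count `6(8L+1)³` drops below `1` only when
`⌊(log*₂ L − 6)/2⌋ > 2^{2446}·log 8`, i.e. at tower heights beyond any physical scale: an explicit function tending to `0` and nothing more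
(the MC guidance `π(64) ≈ 0.126` suggests the TRUE factor `8θ_L(p_c)` is `< 1` from `L ≈ 64` on; not a theorem).
[cite: DewanMuirhead2022, §2 proof of Thm. 1.10 ((p_c − p')² R^d P_{p_c}[A_1(R)] ≥ c)]
-/

noncomputable section

namespace Summit.CriticalPhenomena.PercolationContinuityZ3.Theorems.CrossingRevealment

open MeasureTheory Literature.Probability.Percolation Literature.Probability.LatticeModels
open Summit.CriticalPhenomena.PercolationContinuityZ3.Theorems.SurfaceTension
open Summit.CriticalPhenomena.PercolationContinuityZ3.Theorems.Quant

/-- **THE ONE-ARM WINDOW ON `ℤ³`, NUMERAL FORM**: for `0 < p ≤ p_c(ℤ³)` and `L ≥ 1`, if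
`(p_c − p)²·48(8L+1)³·(1 − 2⁻²⁴⁴⁶)^⌊(log*₂ L − 6)/2⌋ ≤ 85⁻³·p·(1 − p_c)` then `P_p(Λ(L) ↔ ∂ⁱⁿΛ(4L) in Λ(4L)) ≥ 85⁻³/4`
(`…WindowOneArm` §2 with `θ_L(p_c) ≤ (1 − 2⁻²⁴⁴⁶)^⌊(log*₂ L − 6)/2⌋`, `EpsSharp.oneArm_rate_Z3_six_sharp`).  Every symbol except `p, L` is a
kernel numeral; honest size as in the file header. [cite: DewanMuirhead2022, §2 proof of Thm. 1.10] -/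
theorem le_real_boxCrossing_of_window_Z3_numeral (p : unitInterval) (hp0 : 0 < (p : ℝ))
    (hpc : (p : ℝ) ≤ criticalProbI 3) {L : ℕ} (hL : 1 ≤ L)
    (hwin : ((criticalProbI 3 : ℝ) - p) ^ 2 * (48 * (8 * (L : ℝ) + 1) ^ 3
        * (1 - (1 / 2 : ℝ) ^ 2446) ^ ((logStar 2 L - 6) / 2)) ≤ ((85 : ℝ) ^ 3)⁻¹ * p * (1 - criticalProbI 3)) :
    ((85 : ℝ) ^ 3)⁻¹ / 4 ≤ (bondPercolation (zdGraph 3) p).real (boxCrossing 3 L (4 * L)) := by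
  have hθ : (bondPercolation (zdGraph 3) (criticalProbI 3)).real (siteToBoundary 3 L)
      ≤ (1 - (1 / 2 : ℝ) ^ 2446) ^ ((logStar 2 L - 6) / 2) := EpsSharp.oneArm_rate_Z3_six_sharp L
  refine le_real_boxCrossing_of_window_oneArm (d := 3) (by norm_num) p hp0 hpc hL (le_trans ?_ hwin)
  have h48 : (16 * (3 : ℕ) * (8 * (L : ℝ) + 1) ^ 3 : ℝ) = 48 * (8 * (L : ℝ) + 1) ^ 3 := by push_cast; ring
  rw [h48]
  exact mul_le_mul_of_nonneg_left (mul_le_mul_of_nonneg_left hθ (by positivity)) (sq_nonneg _)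

end Summit.CriticalPhenomena.PercolationContinuityZ3.Theorems.CrossingRevealment

end
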